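import Mathlib
import Summits.NavierStokesRegularity.NavierStokesRegularity.Theorems.TaoLadderRungTwoFlatWindowDeviation
import HarnessLib

/-!
# K4 ZONE LEVELS AT TUBE HOPS FROM THE LOOPS OF RECORD: the behind plain levels (exponential in depth, from the block energies of every depth) and
  the window-bottom levels (`M + A` on `[−K, 1−K]`) along EVERY exact flow from a ball state on the WHOLE `[0, s]`, `s ≤ c₀` — the `hlev` input of
  `apriori_tube_of_levels` / `apriori_tube_uniform` below the E2 window (referee c100 A-133)
  (helper for the K_A♭ parent item stmt-NavierStokesRegularity-22987 `FlatGapCertificatesV2`, child 2A `GradedAdiabaticWakeA` of route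
  TaoLadderRungTwoFlat; cell harvest/h2-tao-ladder, p1 g25; LADDER §54–§61, §50 K4)

The in-hop exports `behindBlockEnergies_of_schedule_slot` (block energies) and `windowDeviation_of_schedule_slot` (window deviation) are
instantiated at HORIZON `s` (`c₀ := s`, good time `:= s`): a flow on `[0, s]` from a ball state is a hop premise with clock `s`, and every
row at `c₀` implies the same row at `s ≤ c₀` (pump, levels, rates are monotone in the horizon; nonnegative brackets). The block energy of the
depth reaching shell `k < −K` gives `|S_{ik}(t)| ≤ √(2(V₀B + Ē c₀))·e^{θ′/2}·e^{(θ′/2)(−K−k)}` (`R54.abs_le_of_blockEnergy_le`; edge `≤ −K+1`),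
i.e. `Hb` with `C_b = √(2(V₀B + Ēc₀))·e^{θ′/2}`, `θ_b′ = θ′/2 < (5/2)log(1+ε₀)` for the slow exponent `θ′ ≤ 2log(1+ε₀)`; the window deviation
gives `|S_{ik}(t)| ≤ M + A` on `[−K, 1−K]`.

* `zoneLevels_of_schedule_slot`.

HONEST FRAMING: composition over the cell's typed induction frame (MODEL lattice, graded mirror table on `S♭`); rows, reference family and the
in-hop core input `hcore2` (E2) are HYPOTHESES; the core window `[2−K, k_H+1]` stays an E2 hull row; nothing certified; no item closed; nothing
about the Navier–Stokes equations.
-/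

noncomputable section

-- the sub-problem namespace repeats the summit name by design (D-0017)
set_option linter.dupNamespace false

namespace Summit.NavierStokesRegularity.NavierStokesRegularity.Theorems.HopTube

open Set Finset Literature.Analysis.FluidPDE Literature.Analysis.FluidPDE.TaoCascade MirrorPulse GappedFrontRobustOn

section Zone

variable {ε ε₀ : ℝ}

/-- **K4 ZONE LEVELS AT A TUBE HOP from the loops of record, along every exact flow from a ball state on `[0, s]`, `s ≤ c₀`.**
See the module docstring. [cite: Tao2016AveragedNS, §4 (4.1), (4.3), (4.5), (4.8), §6.3–6.4 (statement shape); route TaoLadderRungTwoFlat, joint a-priori loop + K4 (cell LADDER §50, §54–§61)] -/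
theorem zoneLevels_of_schedule_slot (P : TubeSchedule) {θ' : ℝ} {Wb : ℕ → ℝ} {i₀ : Fin 2}
    {Bcl : ℕ → (Fin 2 → ℤ → ℝ) → Prop} (hBcl : ∀ m z, Bcl m z → behindR54 P θ' Wb m z)
    {X₀ : Fin 2 → ℝ} {w : ℤ → ℝ} {r c₀ : ℝ} {ζ : ℕ → Fin 2 → ℤ → ℝ} {ustar : Fin 2 → ℤ → ℝ}
    {n : ℕ}
    {cW κ₂ : ℝ} {W₀ FW₀ BW₀ : (Fin 2 → ℤ → ℝ) → Fin 2 → ℤ → ℝ} {W FW : (Fin 2 → ℤ → ℝ) → Fin 2 → ℤ → ℝ → ℝ}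
    (hWflow : ∀ z, InTubeWith P Bcl i₀ X₀ w r ζ ustar n z →
      PseudoFlowOnShift shiftSetFlat cW ε₀ (mirrorTable ε ε) 0 κ₂ (W₀ z) (FW₀ z) (BW₀ z) (W z) (FW z)) (hcW : c₀ ≤ cW)
    (hε : 0 ≤ ε) (hε₀ : 0 < ε₀) (hn : P.N₀ < n) (hK : 1 ≤ P.K) (hDK : P.K + 1 ≤ P.D) (hθV : 0 < P.θV)
    (hθ : 0 < θ') (hθ5 : θ' ≤ 5 * Real.log (1 + ε₀)) (hw1 : ∀ k, 1 ≤ w k) (hr0 : 0 ≤ r)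
    (hAstar : 0 < P.Astar) {ωK MuK : ℝ} (hωK : 0 < ωK)
    (hωKle : ∀ i, ωK ≤ MirrorPulse.geomGauge P.g P.b i (-(P.K : ℤ))) (hMuK : ∀ i, |ustar i (-(P.K : ℤ))| ≤ MuK)
    (hWbn : 0 ≤ Wb n)
    (hc₀ : 0 < c₀)
    {Aeff A A₀ A₁ M M₁ M₂ rI RBAR BBAR RHO2 rs I₁ I₂ PUMP μN μB VbarN VbarB EW V₀N V₀B EN : ℝ}
    (hAeff : 0 < Aeff) (hM0 : 0 ≤ M)
    (hM : ∀ z, InTubeWith P Bcl i₀ X₀ w r ζ ustar n z →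
      ∀ s ∈ Icc 0 c₀, ∀ i, ∀ m ∈ Finset.Icc (-(P.D : ℤ)) (1 - (P.K : ℤ)), |W z i m s| ≤ M)
    (hM₁ : ∀ z, InTubeWith P Bcl i₀ X₀ w r ζ ustar n z → ∀ s ∈ Icc 0 c₀, |W z 1 (-(P.K : ℤ)) s| ≤ M₁)
    (hM₂0 : 0 ≤ M₂)
    (hM₂ : ∀ z, InTubeWith P Bcl i₀ X₀ w r ζ ustar n z → ∀ s ∈ Icc 0 c₀, |W z 0 (2 - (P.K : ℤ)) s| ≤ M₂)
    (hEW : ∀ z, InTubeWith P Bcl i₀ X₀ w r ζ ustar n z →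
      coMovingEnergyOn (Finset.Icc (1 - (P.D : ℤ)) (-(P.K : ℤ))) P.θV (-(P.K : ℝ))
        (fun i k _ => anchorScale P i₀ z * ustar i k - W₀ z i k) 0 ≤ EW)
    -- section datum at the interface shell and the deeper core input (the only in-hop core data)
    (hsec : ∀ z S₀ s S F, InTubeWith P Bcl i₀ X₀ w r ζ ustar n z → (∀ i k, w k * |S₀ i k - z i k| ≤ r) → 0 < s → s ≤ c₀ →
      PseudoFlowOnShift shiftSetFlat s ε₀ (mirrorTable ε ε) 0 0 S₀ (fun i k => (1 / 2) * S₀ i k ^ 2) (fun _ _ => 0) S F →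
        ∀ i, |(S - W z) i (1 - (P.K : ℤ)) 0| ≤ rs)
    (hρ0 : 0 ≤ RHO2)
    (hcore2 : ∀ z S₀ s S F, InTubeWith P Bcl i₀ X₀ w r ζ ustar n z → (∀ i k, w k * |S₀ i k - z i k| ≤ r) → 0 < s → s ≤ c₀ →
      PseudoFlowOnShift shiftSetFlat s ε₀ (mirrorTable ε ε) 0 0 S₀ (fun i k => (1 / 2) * S₀ i k ^ 2) (fun _ _ => 0) S F →
        ∀ s' ∈ Icc 0 s, |(S - W z) 0 (2 - (P.K : ℤ)) s'| ≤ RHO2)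
    -- interface levels (L-61a/L-61b) and link facts
    (hRB0 : 0 ≤ RBAR) (hBB0 : 0 ≤ BBAR) (hRr : RBAR ≤ rI) (hBr : BBAR ≤ rI) (hVN0 : 0 ≤ VbarN)
    (hI₁0 : 0 ≤ I₁) (hI₂0 : 0 ≤ I₂)
    (hI₁ : 2 * (Real.exp (P.θV / 2) - 1) ≤ I₁ * P.θV) (hI₂ : Real.exp P.θV - 1 ≤ I₂ * P.θV)
    (hPUMPdef : PUMP = 1 * c₀ * ((2 + ε) * M * I₁ * Real.sqrt (2 * VbarN) + 2 * I₂ * VbarN))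
    (hlevC : rs + PUMP + 1 * c₀ * ((ε * (M + I₁ * Real.sqrt (2 * VbarN)) + ε * M + ε * BBAR) * RBAR
      + (2 + ε) * M * BBAR + BBAR ^ 2) < RBAR)
    (hlevV : rs + 1 * c₀ * ((M + M₂ + RBAR + RHO2) * BBAR + (1 + 2 * ε) * M * RBAR + ε * RBAR ^ 2
      + (M + 2 * ε * M₂) * RHO2 + ε * RHO2 ^ 2) < BBAR)
    -- near/behind schedule (window forms)
    (hAdef : A = Real.sqrt (2 * VbarB) * Real.exp (θ' / 2) * Real.exp (θ' * ((P.D : ℝ) - P.K) / 2) + M)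
    (hA₀def : A₀ = M + rI) (hA₁def : A₁ = M₁ + Real.sqrt (2 * VbarN) * Real.exp (P.θV / 2))
    (hrA : rI ≤ A) (hA₀le : A₀ ≤ Aeff)
    (hV₀Ndef : V₀N = (Real.sqrt (P.v n + (P.δ n / ωK) ^ 2) + Real.sqrt P.D * r + Real.sqrt EW) ^ 2)
    (hV₀Bdef : V₀B = (Real.sqrt (Wb n + (MuK + P.δ n / ωK) ^ 2) + r / Real.sqrt (1 - Real.exp (-θ'))) ^ 2)
    (hENdef : EN = Real.exp (P.θV * ((1 : ℝ) - P.D + P.K)) * ((1 + ε) * 1 * A ^ 2 * (A + M))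
      + 1 * rI * (2 * VbarN + ε * rI * Real.sqrt (2 * VbarN) + (1 + ε) * M * rI))
    (hμN : 0 < μN)
    (hμNle : μN ≤ (1 / c₀) * P.θV - 2 * (1 + ε) * 1 * (A * Real.sinh (P.θV / 2) + M * (3 + Real.exp P.θV)))
    (hμB : 0 < μB) (hμBle : μB ≤ (1 / c₀) * θ' - 2 * (1 + ε) * Aeff * Real.sinh (θ' / 2))
    (hlevN : V₀N + EN * c₀ < VbarN) (hlevB : V₀B + A₁ * A₀ * (A₁ + ε * A₀) * c₀ < VbarB)
    (hclose : Real.sqrt (2 * VbarB) * Real.exp (θ' / 2) ≤ Aeff) :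
    ∀ z S₀ s S F, InTubeWith P Bcl i₀ X₀ w r ζ ustar n z → (∀ i k, w k * |S₀ i k - z i k| ≤ r) → 0 < s → s ≤ c₀ →
      PseudoFlowOnShift shiftSetFlat s ε₀ (mirrorTable ε ε) 0 0 S₀ (fun i k => (1 / 2) * S₀ i k ^ 2) (fun _ _ => 0) S F →
        ∀ t ∈ Icc 0 s, ∀ (i : Fin 2) (k : ℤ),
          (k < -(P.K : ℤ) → |S i k t| ≤ Real.sqrt (2 * (V₀B + A₁ * A₀ * (A₁ + ε * A₀) * c₀)) * Real.exp (θ' / 2)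
              * Real.exp (θ' / 2 * (-(P.K : ℝ) - k))) ∧
          (-(P.K : ℤ) ≤ k → k ≤ 1 - (P.K : ℤ) → |S i k t| ≤ M + A) := by
  have hε₀' : (-1 : ℝ) < ε₀ := by linarith
  intro z S₀ s S F hz hkick hs hsc hS t ht i k
  have hzW := hz
  -- nonnegativity of the row brackets (monotonicity in the horizon)
  have hrI0 : 0 ≤ rI := hRB0.trans hRr
  have hA0 : 0 ≤ A := hrI0.trans hrA
  have hEN0 : 0 ≤ EN := by rw [hENdef]; positivity
  have hM₁0 : 0 ≤ M₁ := (abs_nonneg _).trans (hM₁ z hzW 0 ⟨le_rfl, hc₀.le⟩)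
  have hA₁0 : 0 ≤ A₁ := by rw [hA₁def]; positivity
  have hA₀0 : 0 ≤ A₀ := by rw [hA₀def]; positivity
  have hEtop0 : 0 ≤ A₁ * A₀ * (A₁ + ε * A₀) := by positivity
  have hsq0 : 0 ≤ Real.sqrt (2 * VbarN) := Real.sqrt_nonneg _
  -- the exports at horizon `s` (good time `= s`)
  have hwin_s : ∀ z' S₀' τ' S' F', HopPremiseWith P Bcl shiftSetFlat ε₀ i₀ (mirrorTable ε ε) X₀ w r s ζ ustar n z' S₀' τ' S' F' →
      ∀ t', (fun (_ : ℕ) (_ : Fin 2 → ℤ → ℝ → ℝ) (t' : ℝ) => t' = s) n S' t' → s ≤ t' ∧ t' ≤ s := by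
    intro _ _ _ _ _ _ t' ht'
    have ht'' : t' = s := ht'
    subst ht''; exact ⟨le_rfl, le_rfl⟩
  have hsec_s : ∀ z' S₀' τ' S' F', HopPremiseWith P Bcl shiftSetFlat ε₀ i₀ (mirrorTable ε ε) X₀ w r s ζ ustar n z' S₀' τ' S' F' →
      ∀ i, |(S' - W z') i (1 - (P.K : ℤ)) 0| ≤ rs := by
    intro z' S₀' τ' S' F' hp
    obtain ⟨hz', hk', hsτ, hfl⟩ := hp
    exact hsec z' S₀' s S' F' hz' hk' hs hsc (pseudoFlowOnShift_mono hfl hs hsτ)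
  have hcore2_s : ∀ z' S₀' τ' S' F', HopPremiseWith P Bcl shiftSetFlat ε₀ i₀ (mirrorTable ε ε) X₀ w r s ζ ustar n z' S₀' τ' S' F' →
      ∀ t', (fun (_ : ℕ) (_ : Fin 2 → ℤ → ℝ → ℝ) (t' : ℝ) => t' = s) n S' t' → ∀ s' ∈ Icc 0 t', |(S' - W z') 0 (2 - (P.K : ℤ)) s'| ≤ RHO2 := by
    intro z' S₀' τ' S' F' hp t' ht' s' hs'
    have ht'' : t' = s := ht'
    subst ht''
    obtain ⟨hz', hk', hsτ, hfl⟩ := hp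
    exact hcore2 z' S₀' t' S' F' hz' hk' hs hsc (pseudoFlowOnShift_mono hfl hs hsτ) s' hs'
  have hM_s : ∀ z', InTubeWith P Bcl i₀ X₀ w r ζ ustar n z' →
      ∀ s' ∈ Icc 0 s, ∀ i, ∀ m ∈ Finset.Icc (-(P.D : ℤ)) (1 - (P.K : ℤ)), |W z' i m s'| ≤ M :=
    fun z' hz' s' hs' => hM z' hz' s' ⟨hs'.1, hs'.2.trans hsc⟩
  have hM₁_s : ∀ z', InTubeWith P Bcl i₀ X₀ w r ζ ustar n z' → ∀ s' ∈ Icc 0 s, |W z' 1 (-(P.K : ℤ)) s'| ≤ M₁ :=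
    fun z' hz' s' hs' => hM₁ z' hz' s' ⟨hs'.1, hs'.2.trans hsc⟩
  have hM₂_s : ∀ z', InTubeWith P Bcl i₀ X₀ w r ζ ustar n z' → ∀ s' ∈ Icc 0 s, |W z' 0 (2 - (P.K : ℤ)) s'| ≤ M₂ :=
    fun z' hz' s' hs' => hM₂ z' hz' s' ⟨hs'.1, hs'.2.trans hsc⟩
  have hPUMP0 : 0 ≤ (2 + ε) * M * I₁ * Real.sqrt (2 * VbarN) + 2 * I₂ * VbarN := by positivity
  have hXC0 : 0 ≤ (ε * (M + I₁ * Real.sqrt (2 * VbarN)) + ε * M + ε * BBAR) * RBAR + (2 + ε) * M * BBAR + BBAR ^ 2 := by positivity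
  have hXV0 : 0 ≤ (M + M₂ + RBAR + RHO2) * BBAR + (1 + 2 * ε) * M * RBAR + ε * RBAR ^ 2 + (M + 2 * ε * M₂) * RHO2 + ε * RHO2 ^ 2 := by
    positivity
  have hlevC_s : rs + 1 * s * ((2 + ε) * M * I₁ * Real.sqrt (2 * VbarN) + 2 * I₂ * VbarN)
      + 1 * s * ((ε * (M + I₁ * Real.sqrt (2 * VbarN)) + ε * M + ε * BBAR) * RBAR + (2 + ε) * M * BBAR + BBAR ^ 2) < RBAR := by
    rw [hPUMPdef] at hlevC
    have h1 := mul_le_mul_of_nonneg_right hsc hPUMP0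
    have h2 := mul_le_mul_of_nonneg_right hsc hXC0
    linarith only [hlevC, h1, h2]
  have hlevV_s : rs + 1 * s * ((M + M₂ + RBAR + RHO2) * BBAR + (1 + 2 * ε) * M * RBAR + ε * RBAR ^ 2
      + (M + 2 * ε * M₂) * RHO2 + ε * RHO2 ^ 2) < BBAR := by
    have h2 := mul_le_mul_of_nonneg_right hsc hXV0
    linarith only [hlevV, h2]
  have h1s : 1 / c₀ ≤ 1 / s := one_div_le_one_div_of_le hs hsc
  have hμNle_s : μN ≤ (1 / s) * P.θV - 2 * (1 + ε) * 1 * (A * Real.sinh (P.θV / 2) + M * (3 + Real.exp P.θV)) := by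
    have h2 := mul_le_mul_of_nonneg_right h1s hθV.le
    linarith only [h2, hμNle]
  have hμBle_s : μB ≤ (1 / s) * θ' - 2 * (1 + ε) * Aeff * Real.sinh (θ' / 2) := by
    have h2 := mul_le_mul_of_nonneg_right h1s hθ.le
    linarith only [h2, hμBle]
  have hlevN_s : V₀N + EN * s < VbarN := by
    have h2 := mul_le_mul_of_nonneg_left hsc hEN0
    linarith only [h2, hlevN]
  have hlevB_s : V₀B + A₁ * A₀ * (A₁ + ε * A₀) * s < VbarB := by
    have h2 := mul_le_mul_of_nonneg_left hsc hEtop0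
    linarith only [h2, hlevB]
  have hprem : HopPremiseWith P Bcl shiftSetFlat ε₀ i₀ (mirrorTable ε ε) X₀ w r s ζ ustar n z S₀ s S F := ⟨hz, hkick, le_rfl, hS⟩
  have hblocks := behindBlockEnergies_of_schedule_slot (good := fun (_ : ℕ) (_ : Fin 2 → ℤ → ℝ → ℝ) (t' : ℝ) => t' = s) P hBcl hWflow
    (hsc.trans hcW) hε hε₀ hn hK hDK hθV hθ hθ5 hw1 hr0 hAstar hωK hωKle hMuK hWbn hs hwin_s hAeff hM0 hM_s hM₁_s hM₂0 hM₂_s hEW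
    hsec_s hρ0 hcore2_s hRB0 hBB0 hRr hBr hVN0 hI₁0 hI₂0 hI₁ hI₂ rfl hlevC_s hlevV_s hAdef hA₀def hA₁def hrA hA₀le hV₀Ndef hV₀Bdef
    hENdef hμN hμNle_s hμB hμBle_s hlevN_s hlevB_s hclose z S₀ s S F hprem s rfl t ht
  have hdev := windowDeviation_of_schedule_slot (good := fun (_ : ℕ) (_ : Fin 2 → ℤ → ℝ → ℝ) (t' : ℝ) => t' = s) P hBcl hWflow
    (hsc.trans hcW) hε hε₀ hn hK hDK hθV hθ hθ5 hw1 hr0 hAstar hωK hωKle hMuK hWbn hs hwin_s hAeff hM0 hM_s hM₁_s hM₂0 hM₂_s hEW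
    hsec_s hρ0 hcore2_s hRB0 hBB0 hRr hBr hVN0 hI₁0 hI₂0 hI₁ hI₂ rfl hlevC_s hlevV_s hAdef hA₀def hA₁def hrA hA₀le hV₀Ndef hV₀Bdef
    hENdef hμN hμNle_s hμB hμBle_s hlevN_s hlevB_s hclose z S₀ s S F hprem s rfl t ht
  refine ⟨fun hk => ?_, fun hk1 hk2 => ?_⟩
  · -- behind: block energy of depth reaching `k`, sup extraction, monotone weights
    have hL := hblocks (1 - (P.K : ℤ) - k).toNat
    have hkmem : k ∈ Finset.Icc (1 - (P.K : ℤ) - ((1 - (P.K : ℤ) - k).toNat : ℤ)) (-(P.K : ℤ)) := by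
      rw [Finset.mem_Icc]
      have : ((1 - (P.K : ℤ) - k).toNat : ℤ) = 1 - (P.K : ℤ) - k := Int.toNat_of_nonneg (by omega)
      omega
    have habs := R54.abs_le_of_blockEnergy_le hL i hkmem
    have hV : V₀B + A₁ * A₀ * (A₁ + ε * A₀) * t ≤ V₀B + A₁ * A₀ * (A₁ + ε * A₀) * c₀ := by
      have := mul_le_mul_of_nonneg_left (ht.2.trans hsc) hEtop0; linarith only [this]
    have hV0 : 0 ≤ V₀B + A₁ * A₀ * (A₁ + ε * A₀) * t := (coMovingEnergyOn_nonneg _ _ _ _ _).trans hL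
    have hne : -(P.K : ℝ) + 1 / s * t ≤ -(P.K : ℝ) + 1 := by
      have : 1 / s * t ≤ 1 := by rw [one_div, inv_mul_le_iff₀ hs]; linarith only [ht.2]
      linarith only [this]
    have hexp : Real.exp (θ' * (-(P.K : ℝ) + 1 / s * t - k) / 2) ≤ Real.exp (θ' / 2) * Real.exp (θ' / 2 * (-(P.K : ℝ) - k)) := by
      rw [← Real.exp_add]
      apply Real.exp_le_exp.mpr
      have h1 := mul_le_mul_of_nonneg_left hne hθ.le
      have e1 : θ' * (-(P.K : ℝ) + 1 / s * t - k) / 2 = (θ' * (-(P.K : ℝ) + 1 / s * t) - θ' * k) / 2 := by ring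
      have e2 : θ' / 2 + θ' / 2 * (-(P.K : ℝ) - k) = (θ' * (-(P.K : ℝ) + 1) - θ' * k) / 2 := by ring
      rw [e1, e2]
      linarith only [h1]
    calc |S i k t| ≤ Real.sqrt (2 * (V₀B + A₁ * A₀ * (A₁ + ε * A₀) * t)) * Real.exp (θ' * (-(P.K : ℝ) + 1 / s * t - k) / 2) := habs
      _ ≤ Real.sqrt (2 * (V₀B + A₁ * A₀ * (A₁ + ε * A₀) * c₀)) * (Real.exp (θ' / 2) * Real.exp (θ' / 2 * (-(P.K : ℝ) - k))) :=
          mul_le_mul (Real.sqrt_le_sqrt (by linarith only [hV])) hexp (Real.exp_pos _).le (Real.sqrt_nonneg _)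
      _ = _ := by ring
  · -- window bottom: template + deviation
    have hd := hdev i k (by rw [Finset.mem_Icc]; omega)
    have hW := hM z hzW t ⟨ht.1, ht.2.trans hsc⟩ i k (by rw [Finset.mem_Icc]; omega)
    have e : S i k t = W z i k t + (S - W z) i k t := by simp only [Pi.sub_apply]; ring
    rw [e]
    exact (abs_add_le _ _).trans (add_le_add hW hd)

end Zone

end Summit.NavierStokesRegularity.NavierStokesRegularity.Theorems.HopTube

end
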